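import Summits.QuantumAdvantage.QuantumAdvantage.Theorems.CubicForrelationNearExactIsExactTenDigits
import Summits.QuantumAdvantage.QuantumAdvantage.Theorems.CubicForrelationNearExactIsExactTenWindow
import Summits.QuantumAdvantage.QuantumAdvantage.Theorems.CubicForrelationNearExactIsExactAutocorr
import Summits.QuantumAdvantage.QuantumAdvantage.Theorems.CubicForrelationSignedExactSliceIsLiftStubMoebius

/-!
# Crux `CubicForrelation.NearExactIsExact` (stmt-QuantumAdvantage-14043) — PARTNER RIGIDITY on 10 bits at `θ = 7/8`

Seat `b2b-cforr-cert` (n = 10, θ = 7/8 certificate rung), file 2 of the computation-free proof.  HONEST FRAMING: a theorem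
about cubic pairs on 10 bits — NOT summit progress.

Setting: `f, g : 𝔽₂¹⁰ → 𝔽₂` cubic, `W_g = 16·u` (Ax), and the RESIDUAL `τ(x) := u(x) − 2·(−1)^{f(x)}`.  The budget identity
`Σ_x τ(x)² = 2¹³(1 − Φ(f,g))` (`tp_budget`) turns `Φ > 7/8` into `Σ τ² < 1024`; the split hyperplane `L = {u odd}` has
`512` points (`tp_card_odd`), each contributing `≥ 1`.  With the mixed digits `d₁ = [⌊u/2⌋ odd]` (quadratic) and
`d₂ = [⌊u/4⌋ odd]` (degree `≤ 4`) of the landed `TenDigits` file and the Reed–Muller minimum weight (`bb_rmWeight_holds`):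
* `tp_digitOne_of_even`: off `L`, `u ≡ 2 (mod 4)` (the function `¬d₀ ∧ ¬d₁`, of degree `≤ 3`, has `< 128` points);
* `tp_partner`: **`f = d₂`** — the cubic partner of `g` in the window `7/8 < Φ < 1` IS the third 2-adic digit of `W_g/16`
  (the degree-`≤ 4` function `f ⊕ d₂` has `< 64` points: each costs `≥ 8` in the budget);
* `tp_residue_even` / `tp_residue_odd`: consequently `τ ≡ 0 (mod 8)` off `L` and `τ ≡ χ (mod 8)` on `L`, `χ := 2d₁ − 1`.
These feed the character-sum and counting files that finish `isolation_ten_78`.  Paper proof: seat folder `PROOF.md` §2.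
References: C. Carlet, *Boolean Functions for Cryptography and Coding Theory*, CUP 2021, §2.2, §4.1; F. J. MacWilliams,
N. J. A. Sloane (1977) Ch. 13–15 (Reed–Muller weights).  Axioms: the standard three.
-/

set_option linter.dupNamespace false -- D-0017: single-problem summit ⇒ `QuantumAdvantage.QuantumAdvantage` by design

noncomputable section

namespace Summit.QuantumAdvantage.QuantumAdvantage.Theorems.CubicForrelation.NearExactIsExact

open Finset
open Literature.Computability.QuantumComplexity
open Literature.Computability.QuantumComplexity.BuzetChailloux (bxor zeroVec signOf_sq twist_zeroVec_right bxor_zeroVec)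
open Literature.Computability.QuantumComplexity.DerivativeWalsh (W)
open Summit.QuantumAdvantage.QuantumAdvantage.Theorems.SignedExactSliceIsLift.StubMoebius (isDegLeFun_xor isDegLeFun_and)

/-! ### Integer signs and pointwise residue arithmetic -/

/-- The integer sign `(−1)^{[b]}`. [folklore] -/
def sZ (b : Bool) : ℤ := if b then -1 else 1

/-- `sZ` casts to `signOf`. [folklore] -/
theorem tp_sZ_cast (b : Bool) : ((sZ b : ℤ) : ℝ) = signOf b := by
  cases b <;> simp [sZ, signOf]

/-- `sZ b = 1 ∨ sZ b = −1`. [folklore] -/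
theorem tp_sZ_cases (b : Bool) : sZ b = 1 ∨ sZ b = -1 := by
  cases b <;> simp [sZ]

/-- `sZ b = −1 ↔ b = true`. [folklore] -/
theorem tp_sZ_eq_neg_one_iff (b : Bool) : sZ b = -1 ↔ b = true := by
  cases b <;> simp [sZ]

/-- Squares beyond a threshold: `t ≤ −k ∨ k ≤ t ⇒ k² ≤ t²` (`k ≥ 0`). [folklore] -/
theorem tp_sq_ge {t k : ℤ} (hk : 0 ≤ k) (h : t ≤ -k ∨ k ≤ t) : k ^ 2 ≤ t ^ 2 := by
  rcases h with h | h <;> nlinarith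

/-- An odd `a` gives an odd residual: `(a − 2s)² ≥ 1`. [folklore] -/
theorem tp_res_sq_ge_one {a s : ℤ} (hs : s = 1 ∨ s = -1) (ha : Odd a) : 1 ≤ (a - 2 * s) ^ 2 := by
  have h1 := Int.odd_iff.1 ha
  have key : a - 2 * s ≤ -1 ∨ 1 ≤ a - 2 * s := by rcases hs with hs | hs <;> rw [hs] <;> omega
  have := tp_sq_ge (k := 1) (by norm_num) key
  simpa using this

/-- `a ≡ 0 (mod 4)` gives `(a − 2s)² ≥ 4`. [folklore] -/
theorem tp_res_sq_ge_four {a s : ℤ} (hs : s = 1 ∨ s = -1) (h0 : ¬ Odd a) (h1 : ¬ Odd (a / 2)) :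
    4 ≤ (a - 2 * s) ^ 2 := by
  have e0 := Int.even_iff.1 (Int.not_odd_iff_even.1 h0)
  have e1 := Int.even_iff.1 (Int.not_odd_iff_even.1 h1)
  have key : a - 2 * s ≤ -2 ∨ 2 ≤ a - 2 * s := by rcases hs with hs | hs <;> rw [hs] <;> omega
  have := tp_sq_ge (k := 2) (by norm_num) key
  simpa using this

/-- The MISMATCH cost: if `⌊a/2⌋` is odd whenever `a` is even, and the sign `s` disagrees with the third digit
(`s = −1 ↮ ⌊a/4⌋ odd`), then `(a − 2s)² − [a odd] ≥ 8` (`τ ≡ 4 (mod 8)` resp. `τ ≡ ±3 (mod 8)`). [this work] -/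
theorem tp_cost_of_mismatch {a s : ℤ} (hs : s = 1 ∨ s = -1) (h1 : ¬ Odd a → Odd (a / 2))
    (hmis : ¬ (s = -1 ↔ Odd (a / 2 / 2))) :
    8 ≤ (a - 2 * s) ^ 2 - (if Odd a then 1 else 0) := by
  obtain ⟨q, hq⟩ := td_mod_eight a
  by_cases h0 : Odd a
  · -- on `L`: `τ ≡ ±3 (mod 8)`
    rw [if_pos h0] at hq ⊢
    have key : a - 2 * s ≤ -3 ∨ 3 ≤ a - 2 * s := by
      by_cases ha1 : Odd (a / 2) <;> by_cases ha2 : Odd (a / 2 / 2) <;>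
        simp only [ha1, ha2, if_true, if_false, iff_true, iff_false, not_not] at hq hmis <;>
        rcases hs with rfl | rfl <;> omega
    have := tp_sq_ge (k := 3) (by norm_num) key
    linarith
  · -- off `L`: `τ ≡ 4 (mod 8)`
    rw [if_neg h0] at hq ⊢
    have ha1 := h1 h0
    rw [if_pos ha1] at hq
    have key : a - 2 * s ≤ -4 ∨ 4 ≤ a - 2 * s := by
      by_cases ha2 : Odd (a / 2 / 2) <;>
        simp only [ha2, if_true, if_false, iff_true, iff_false, not_not] at hq hmis <;>
        rcases hs with rfl | rfl <;> omega
    have := tp_sq_ge (k := 4) (by norm_num) key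
    linarith

/-- The MATCHED residue: if `⌊a/2⌋` is odd whenever `a` is even and the sign agrees with the third digit, then
`a − 2s ≡ 0 (mod 8)` for even `a` and `a − 2s ≡ 2[⌊a/2⌋ odd] − 1 (mod 8)` for odd `a`. [this work] -/
theorem tp_residue_of_match {a s : ℤ} (hs : s = 1 ∨ s = -1) (h1 : ¬ Odd a → Odd (a / 2))
    (hmatch : s = -1 ↔ Odd (a / 2 / 2)) :
    (8 : ℤ) ∣ a - 2 * s - (if Odd a then (if Odd (a / 2) then 1 else -1) else 0) := by
  obtain ⟨q, hq⟩ := td_mod_eight a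
  by_cases h0 : Odd a
  · rw [if_pos h0] at hq ⊢
    by_cases ha1 : Odd (a / 2) <;> by_cases ha2 : Odd (a / 2 / 2) <;>
      simp only [ha1, ha2, if_true, if_false, iff_true, iff_false] at hq hmatch ⊢ <;>
      rcases hs with rfl | rfl <;> omega
  · rw [if_neg h0] at hq ⊢
    have ha1 := h1 h0
    rw [if_pos ha1] at hq
    by_cases ha2 : Odd (a / 2 / 2) <;>
      simp only [ha2, if_true, if_false, iff_true, iff_false] at hq hmatch ⊢ <;>
      rcases hs with rfl | rfl <;> omega

/-! ### Global identities: Parseval, the budget, the size of the split hyperplane -/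

/-- Parseval on 10 bits for a `±1` table: `Σ_x W_g(x)² = 2²⁰`. [folklore] -/
theorem tp_parseval (g : (Fin (5 + 5) → Bool) → Bool) : ∑ x, W (fun y => signOf (g y)) x ^ 2 = (2 : ℝ) ^ 20 := by
  have h := tb_sum_W_sq_mul_twist (fun y => signOf (g y)) zeroVec
  simp only [twist_zeroVec_right, mul_one, bxor_zeroVec] at h
  rw [h, sum_congr rfl fun y _ => by rw [← sq, signOf_sq], sum_const, card_univ, Fintype.card_fun, Fintype.card_bool,
    Fintype.card_fin]
  norm_num

/-- **The budget identity.** For ANY `f, g` on 10 bits with `W_g = 16u`: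
`Σ_x (u(x) − 2(−1)^{f(x)})² = 2¹³·(1 − Φ(f,g))`. [this work] -/
theorem tp_budget (f g : (Fin (5 + 5) → Bool) → Bool) (u : (Fin (5 + 5) → Bool) → ℤ)
    (hu : ∀ x, W (fun y => signOf (g y)) x = (2 : ℝ) ^ 4 * (u x : ℝ)) :
    ((∑ x, (u x - 2 * sZ (f x)) ^ 2 : ℤ) : ℝ) = (2 : ℝ) ^ 13 * (1 - forrelation f g) := by
  have hP := tp_parseval g
  have hΦ := vg_two_pow_mul_forrelation f g
  have e : ∀ x : Fin (5 + 5) → Bool, ((u x : ℝ) - 2 * (sZ (f x) : ℝ)) ^ 2 =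
      W (fun y => signOf (g y)) x ^ 2 / 256 - signOf (f x) * W (fun y => signOf (g y)) x / 4 + 4 := by
    intro x
    have hux : (u x : ℝ) = W (fun y => signOf (g y)) x / 16 := by rw [hu x]; ring
    have hs2 : signOf (f x) ^ 2 = 1 := signOf_sq _
    rw [tp_sZ_cast, hux]
    nlinarith [hs2]
  push_cast
  rw [sum_congr rfl fun x _ => e x, sum_add_distrib, sum_sub_distrib, ← sum_div, ← sum_div, hP, ← hΦ, sum_const,
    card_univ, Fintype.card_fun, Fintype.card_bool, Fintype.card_fin]
  norm_num
  ring

/-- In the window `Φ > 7/8` the integer budget is `< 1024`. [this work] -/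
theorem tp_budget_lt (f g : (Fin (5 + 5) → Bool) → Bool) (u : (Fin (5 + 5) → Bool) → ℤ)
    (hu : ∀ x, W (fun y => signOf (g y)) x = (2 : ℝ) ^ 4 * (u x : ℝ)) (hΦ : 7 / 8 < forrelation f g) :
    ∑ x, (u x - 2 * sZ (f x)) ^ 2 < 1024 := by
  have h := tp_budget f g u hu
  have h' : ((∑ x, (u x - 2 * sZ (f x)) ^ 2 : ℤ) : ℝ) < 1024 := by rw [h]; nlinarith
  exact_mod_cast h'

/-- `Σ_x (−1)^{h x} = 2¹⁰ − 2·#{h = 1}` on 10 bits. [folklore] -/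
theorem tp_sum_signOf (h : (Fin (5 + 5) → Bool) → Bool) :
    ∑ x, signOf (h x) = (1024 : ℝ) - 2 * #{x : Fin (5 + 5) → Bool | h x = true} := by
  have e : ∀ x : Fin (5 + 5) → Bool, signOf (h x) = 1 - 2 * (if h x = true then (1 : ℝ) else 0) := fun x => by
    unfold signOf; split_ifs <;> norm_num
  rw [sum_congr rfl fun x _ => e x, sum_sub_distrib, sum_const, card_univ, Fintype.card_fun, Fintype.card_bool,
    Fintype.card_fin, ← mul_sum, sum_boole]
  norm_num

/-- **The split hyperplane has `512` points**: if the parity `[u odd]` is the affine character `b₀ ⊕ c·x` with `c ≠ 0`,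
then `#{x : u(x) odd} = 512`. [folklore] -/
theorem tp_card_odd (u : (Fin (5 + 5) → Bool) → ℤ) (c : Fin (5 + 5) → Bool) (b₀ : Bool)
    (hc : ∀ x, signOf (decide (Odd (u x))) = signOf b₀ * twist c x) (hc0 : c ≠ zeroVec) :
    #{x : Fin (5 + 5) → Bool | decide (Odd (u x)) = true} = 512 := by
  have h1 := tp_sum_signOf (fun x => decide (Odd (u x)))
  rw [sum_congr rfl fun x _ => hc x, ← mul_sum, Simon.sum_twist c] at h1
  have hc0' : c ≠ (fun _ => false) := fun h => hc0 (by rw [h]; rfl)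
  rw [if_neg hc0', mul_zero] at h1
  have h2 : (#{x : Fin (5 + 5) → Bool | decide (Odd (u x)) = true} : ℝ) = 512 := by linarith
  exact_mod_cast h2

/-- … and so does its complement: `#{x : u(x) even} = 512`. [folklore] -/
theorem tp_card_even (u : (Fin (5 + 5) → Bool) → ℤ) (c : Fin (5 + 5) → Bool) (b₀ : Bool)
    (hc : ∀ x, signOf (decide (Odd (u x))) = signOf b₀ * twist c x) (hc0 : c ≠ zeroVec) :
    #{x : Fin (5 + 5) → Bool | ¬ Odd (u x)} = 512 := by
  have h := Finset.card_filter_add_card_filter_not (s := (univ : Finset (Fin (5 + 5) → Bool)))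
    (fun x => decide (Odd (u x)) = true)
  rw [tp_card_odd u c b₀ hc hc0, card_univ, Fintype.card_fun, Fintype.card_bool, Fintype.card_fin] at h
  have e : (univ.filter fun x : Fin (5 + 5) → Bool => ¬ decide (Odd (u x)) = true) =
      univ.filter fun x : Fin (5 + 5) → Bool => ¬ Odd (u x) := by
    ext x; simp
  rw [e] at h
  omega

/-- The `L`-part of the budget: `Σ_x [u(x) odd] = 512` (as an integer sum). [folklore] -/
theorem tp_sum_ite_odd_eq (u : (Fin (5 + 5) → Bool) → ℤ) (c : Fin (5 + 5) → Bool) (b₀ : Bool)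
    (hc : ∀ x, signOf (decide (Odd (u x))) = signOf b₀ * twist c x) (hc0 : c ≠ zeroVec) :
    ∑ x : Fin (5 + 5) → Bool, (if Odd (u x) then (1 : ℤ) else 0) = 512 := by
  rw [td_sum_ite_odd]
  have h := tp_card_odd u c b₀ hc hc0
  have e : (univ.filter fun x : Fin (5 + 5) → Bool => Odd (u x)) =
      univ.filter fun x : Fin (5 + 5) → Bool => decide (Odd (u x)) = true := by
    ext x; simp
  rw [e, h]
  norm_num

/-- The COST form of the budget: with `κ(x) := τ(x)² − [u(x) odd] ≥ 0`, `Σ_x κ(x) < 512` in the window. [this work] -/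
theorem tp_cost_sum_lt (f g : (Fin (5 + 5) → Bool) → Bool) (u : (Fin (5 + 5) → Bool) → ℤ)
    (hu : ∀ x, W (fun y => signOf (g y)) x = (2 : ℝ) ^ 4 * (u x : ℝ)) (hΦ : 7 / 8 < forrelation f g)
    (c : Fin (5 + 5) → Bool) (b₀ : Bool) (hc : ∀ x, signOf (decide (Odd (u x))) = signOf b₀ * twist c x)
    (hc0 : c ≠ zeroVec) :
    ∑ x, ((u x - 2 * sZ (f x)) ^ 2 - (if Odd (u x) then (1 : ℤ) else 0)) < 512 := by
  rw [sum_sub_distrib, tp_sum_ite_odd_eq u c b₀ hc hc0]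
  have := tp_budget_lt f g u hu hΦ
  omega

/-- Each cost term is non-negative. [folklore] -/
theorem tp_cost_nonneg (f : (Fin (5 + 5) → Bool) → Bool) (u : (Fin (5 + 5) → Bool) → ℤ) (x : Fin (5 + 5) → Bool) :
    0 ≤ (u x - 2 * sZ (f x)) ^ 2 - (if Odd (u x) then (1 : ℤ) else 0) := by
  by_cases h : Odd (u x)
  · rw [if_pos h]; have := tp_res_sq_ge_one (tp_sZ_cases (f x)) h; linarith
  · rw [if_neg h]; nlinarith

/-! ### The two Reed–Muller steps: `u ≡ 2 (mod 4)` off `L`, and `f = d₂` -/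

/-- A degree-`≤ d` Boolean function on 10 bits with fewer than `2^{10−d}` points is identically `false`
(`bb_rmWeight_holds`). [cite: Carlet2020, §4.1 Thm 7] -/
theorem tp_eq_false_of_card_lt {d : ℕ} (e : (Fin (5 + 5) → Bool) → Bool) (he : IsDegLeFun d e)
    (hlt : 2 ^ d * #{x : Fin (5 + 5) → Bool | e x = true} < 2 ^ (5 + 5)) : ∀ x, e x = false := by
  intro x
  by_contra hx
  rw [Bool.not_eq_false] at hx
  have h := bb_rmWeight_holds (5 + 5) d e he ⟨x, hx⟩
  omega

/-- **Off the split hyperplane `u ≡ 2 (mod 4)`.** For cubic `f, g` on 10 bits with `Φ(f,g) > 7/8`, `W_g = 16u` and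
`[u odd]` a non-constant affine character: `u(x)` even ⇒ `⌊u(x)/2⌋` odd. [this work] -/
theorem tp_digitOne_of_even (f g : (Fin (5 + 5) → Bool) → Bool) (hg : IsDegLeFun 3 g)
    (hΦ : 7 / 8 < forrelation f g) (u : (Fin (5 + 5) → Bool) → ℤ)
    (hu : ∀ x, W (fun y => signOf (g y)) x = (2 : ℝ) ^ 4 * (u x : ℝ)) (c : Fin (5 + 5) → Bool) (b₀ : Bool)
    (hc : ∀ x, signOf (decide (Odd (u x))) = signOf b₀ * twist c x) (hc0 : c ≠ zeroVec) :
    ∀ x, ¬ Odd (u x) → Odd (u x / 2) := by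
  have hP0 : IsDegLeFun 1 (fun x => decide (Odd (u x))) :=
    stub_walshTower stub_axParity (5 + 5) 4 1 g u hg hu (by intro k hk hkn; omega)
  have hP1 := td_digitOne g u hg hu
  set e : (Fin (5 + 5) → Bool) → Bool := fun x => (decide (Odd (u x)) ^^ true) && (decide (Odd (u x / 2)) ^^ true)
    with he_def
  have he : IsDegLeFun 3 e :=
    isDegLeFun_and (isDegLeFun_xor hP0 (isDegLeFun_const 1 true)) (isDegLeFun_xor hP1 (isDegLeFun_const 2 true))
  have he_iff : ∀ x, e x = true ↔ ¬ Odd (u x) ∧ ¬ Odd (u x / 2) := fun x => by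
    simp [he_def]
  -- cost bound: every point of `e` costs `≥ 4`
  have hcost := tp_cost_sum_lt f g u hu hΦ c b₀ hc hc0
  have h4 : (4 : ℤ) * #{x : Fin (5 + 5) → Bool | e x = true} ≤
      ∑ x, ((u x - 2 * sZ (f x)) ^ 2 - (if Odd (u x) then (1 : ℤ) else 0)) := by
    rw [← sum_filter_add_sum_filter_not univ (fun x => e x = true)]
    have hA : ∑ x ∈ univ.filter (fun x => e x = true), (4 : ℤ) ≤
        ∑ x ∈ univ.filter (fun x => e x = true), ((u x - 2 * sZ (f x)) ^ 2 - (if Odd (u x) then (1 : ℤ) else 0)) := by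
      refine sum_le_sum fun x hx => ?_
      obtain ⟨h0, h1⟩ := (he_iff x).1 (mem_filter.1 hx).2
      rw [if_neg h0, sub_zero]
      exact tp_res_sq_ge_four (tp_sZ_cases (f x)) h0 h1
    rw [sum_const, nsmul_eq_mul] at hA
    have hB : (0 : ℤ) ≤ ∑ x ∈ univ.filter (fun x => ¬ e x = true),
        ((u x - 2 * sZ (f x)) ^ 2 - (if Odd (u x) then (1 : ℤ) else 0)) :=
      sum_nonneg fun x _ => tp_cost_nonneg f u x
    linarith
  have hlt : 2 ^ 3 * #{x : Fin (5 + 5) → Bool | e x = true} < 2 ^ (5 + 5) := by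
    have : (#{x : Fin (5 + 5) → Bool | e x = true} : ℤ) < 128 := by linarith
    have : #{x : Fin (5 + 5) → Bool | e x = true} < 128 := by exact_mod_cast this
    norm_num; omega
  have hzero := tp_eq_false_of_card_lt e he hlt
  intro x hx
  by_contra h1
  have : e x = true := (he_iff x).2 ⟨hx, h1⟩
  rw [hzero x] at this
  exact Bool.false_ne_true this

/-- **PARTNER RIGIDITY.** For cubic `f, g : 𝔽₂¹⁰ → 𝔽₂` with `Φ(f,g) > 7/8`, `W_g = 16u` and `[u odd]` a non-constant affine
character (the split configuration, automatic when `Φ < 1`): `f(x) = [⌊⌊u(x)/2⌋/2⌋ odd]` for EVERY `x` — the cubic partner is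
the third 2-adic digit of `W_g/16`. [this work] -/
theorem tp_partner (f g : (Fin (5 + 5) → Bool) → Bool) (hf : IsDegLeFun 3 f) (hg : IsDegLeFun 3 g)
    (hΦ : 7 / 8 < forrelation f g) (u : (Fin (5 + 5) → Bool) → ℤ)
    (hu : ∀ x, W (fun y => signOf (g y)) x = (2 : ℝ) ^ 4 * (u x : ℝ)) (c : Fin (5 + 5) → Bool) (b₀ : Bool)
    (hc : ∀ x, signOf (decide (Odd (u x))) = signOf b₀ * twist c x) (hc0 : c ≠ zeroVec) :
    ∀ x, f x = decide (Odd (u x / 2 / 2)) := by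
  have hP2 := td_digitTwo g u hg hu
  have h1 := tp_digitOne_of_even f g hg hΦ u hu c b₀ hc hc0
  set e : (Fin (5 + 5) → Bool) → Bool := fun x => f x ^^ decide (Odd (u x / 2 / 2)) with he_def
  have he : IsDegLeFun 4 e := isDegLeFun_xor (hf.mono (by norm_num)) hP2
  have he_iff : ∀ x, e x = true ↔ ¬ (sZ (f x) = -1 ↔ Odd (u x / 2 / 2)) := fun x => by
    rw [tp_sZ_eq_neg_one_iff]
    cases hfx : f x <;> simp [he_def, hfx]
  have hcost := tp_cost_sum_lt f g u hu hΦ c b₀ hc hc0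
  have h8 : (8 : ℤ) * #{x : Fin (5 + 5) → Bool | e x = true} ≤
      ∑ x, ((u x - 2 * sZ (f x)) ^ 2 - (if Odd (u x) then (1 : ℤ) else 0)) := by
    rw [← sum_filter_add_sum_filter_not univ (fun x => e x = true)]
    have hA : ∑ x ∈ univ.filter (fun x => e x = true), (8 : ℤ) ≤
        ∑ x ∈ univ.filter (fun x => e x = true), ((u x - 2 * sZ (f x)) ^ 2 - (if Odd (u x) then (1 : ℤ) else 0)) := by
      refine sum_le_sum fun x hx => ?_
      exact tp_cost_of_mismatch (tp_sZ_cases (f x)) (h1 x) ((he_iff x).1 (mem_filter.1 hx).2)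
    rw [sum_const, nsmul_eq_mul] at hA
    have hB : (0 : ℤ) ≤ ∑ x ∈ univ.filter (fun x => ¬ e x = true),
        ((u x - 2 * sZ (f x)) ^ 2 - (if Odd (u x) then (1 : ℤ) else 0)) :=
      sum_nonneg fun x _ => tp_cost_nonneg f u x
    linarith
  have hlt : 2 ^ 4 * #{x : Fin (5 + 5) → Bool | e x = true} < 2 ^ (5 + 5) := by
    have : (#{x : Fin (5 + 5) → Bool | e x = true} : ℤ) < 64 := by linarith
    have : #{x : Fin (5 + 5) → Bool | e x = true} < 64 := by exact_mod_cast this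
    norm_num; omega
  have hzero := tp_eq_false_of_card_lt e he hlt
  intro x
  have hx := hzero x
  cases hfx : f x <;> cases hdx : decide (Odd (u x / 2 / 2)) <;> simp_all

/-- **Residue off `L`.** In the same setting, `u(x)` even ⇒ `8 ∣ τ(x) = u(x) − 2(−1)^{f(x)}`. [this work] -/
theorem tp_residue_even (f g : (Fin (5 + 5) → Bool) → Bool) (hf : IsDegLeFun 3 f) (hg : IsDegLeFun 3 g)
    (hΦ : 7 / 8 < forrelation f g) (u : (Fin (5 + 5) → Bool) → ℤ)
    (hu : ∀ x, W (fun y => signOf (g y)) x = (2 : ℝ) ^ 4 * (u x : ℝ)) (c : Fin (5 + 5) → Bool) (b₀ : Bool)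
    (hc : ∀ x, signOf (decide (Odd (u x))) = signOf b₀ * twist c x) (hc0 : c ≠ zeroVec) :
    ∀ x, ¬ Odd (u x) → (8 : ℤ) ∣ u x - 2 * sZ (f x) := by
  intro x hx
  have h := tp_residue_of_match (tp_sZ_cases (f x)) (tp_digitOne_of_even f g hg hΦ u hu c b₀ hc hc0 x)
    (by rw [tp_sZ_eq_neg_one_iff, tp_partner f g hf hg hΦ u hu c b₀ hc hc0 x]; exact decide_eq_true_iff)
  rwa [if_neg hx, sub_zero] at h

/-- **Residue on `L`.** In the same setting, `u(x)` odd ⇒ `τ(x) ≡ χ(x) (mod 8)` with `χ(x) = 2[⌊u(x)/2⌋ odd] − 1 ∈ {±1}`.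
[this work] -/
theorem tp_residue_odd (f g : (Fin (5 + 5) → Bool) → Bool) (hf : IsDegLeFun 3 f) (hg : IsDegLeFun 3 g)
    (hΦ : 7 / 8 < forrelation f g) (u : (Fin (5 + 5) → Bool) → ℤ)
    (hu : ∀ x, W (fun y => signOf (g y)) x = (2 : ℝ) ^ 4 * (u x : ℝ)) (c : Fin (5 + 5) → Bool) (b₀ : Bool)
    (hc : ∀ x, signOf (decide (Odd (u x))) = signOf b₀ * twist c x) (hc0 : c ≠ zeroVec) :
    ∀ x, Odd (u x) → (8 : ℤ) ∣ u x - 2 * sZ (f x) - (if Odd (u x / 2) then 1 else -1) := by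
  intro x hx
  have h := tp_residue_of_match (tp_sZ_cases (f x)) (tp_digitOne_of_even f g hg hΦ u hu c b₀ hc hc0 x)
    (by rw [tp_sZ_eq_neg_one_iff, tp_partner f g hf hg hΦ u hu c b₀ hc hc0 x]; exact decide_eq_true_iff)
  rwa [if_pos hx] at h

end Summit.QuantumAdvantage.QuantumAdvantage.Theorems.CubicForrelation.NearExactIsExact

end
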